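import Summits.Ventures.QEC.Thresholds.ToricCodeIntervalsKernelSymm
import Summits.Ventures.QEC.Thresholds.ToricCodeHGPIdentification
import Literature.InformationTheory.QuantumCodes.CSSEquivalenceDecoders
import HarnessLib

/-!
# The census toric object `HGP(circ_L, circ_L)` inherits the lattice toric code's SAW-route thresholds, I (code capacity):
# `p_c > .0357` (both sectors), `p_c^{depol} > .0535` — every minimum-weight decoder family — UNCONDITIONAL, kernel

Venture QEC, `Summits/Ventures/QEC/Thresholds/` (LADDER-QEC rung Q5, CENSUS-PREREG cell B.0 / Q5 rows F4–F5; qec-type-09 gen 5, item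
TORHGP-TRANSPORT). qec-type-03's `toricHGPCode_eq_reindex` (`ToricCodeHGPIdentification.lean`) identifies the census / Q5 object
`toricHGPCode k = HGP.code (cycMatrix k) (cycMatrix k)` (`L = k + 2`) with the lattice toric code `toricCode (k+2)` RE-INDEXED;
type-03 transported distances and the loss threshold. This file transports the DECODER-dependent rows through the pull-back of
decoders (`CSSEquivalenceDecoders.lean`: code capacity; `CSSPhenomenologicalReindex.lean`: space-time): every (minimum-weight)
decoder family of the HGP object IS a (minimum-weight) decoder family of the lattice object with the same failure probabilities,
size by size (index shift `k ↦ k + 1`, `isThresholdLowerBound_succ_iff`). Hence the HGP-object rows, which so far carried the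
Dumer–Kovalev–Pryadko cluster constants `p₀(3) ≈ .0286` / `p₀(5) ≈ .0101` (`ToricCodeHGPThresholds.lean`), now carry the
Dennis–Kitaev–Landahl–Preskill self-avoiding-walk constants of the lattice object at qec-type-03's kernel certificates
`μ(ℤ²) ≤ 2.6939`, `μ(ℤ³) ≤ 4.7476`:

| theorem | statement (HGP object `toricHGPCode k`, every `k`) |
|---|---|
| `toricHGP_z_isThresholdLowerBound_of_lattice`, `toricHGP_x_isThresholdLowerBound_of_lattice` | TRANSFER: every lattice `Z`-sector code-capacity bound valid for all min-weight decoder families holds for the HGP object's `Z` resp. `X` sector |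
| `toricHGP_z_accuracyThreshold_gt_0357`, `toricHGP_x_accuracyThreshold_gt_0357` | code capacity, every min-weight decoder family: **`p_c > .0357`** (was `.0285`) |
| `toricHGP_depolarizing_isThresholdLowerBound_kernelSymmK16`, `toricHGP_depolarizing_accuracyThreshold_gt_0535` | depolarizing, sector-wise min-weight: `≥ (3/2)·p₀(2.6939)`, **`> .0535`** (was `.0427`) |

(Phenomenological rows — `p_c^{ph} > .0112` both records, two-rate boxes, three-rate `p ≤ .0168`, `q ≤ .0112` — in the companion
`ToricCodeHGPPhenomTransport.lean`.) All UNCONDITIONAL, tier CERTIFIED (kernel), axioms standard, 0 named facts. Theorem-only file.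

## References

* [KovalevPryadko2012] A. A. Kovalev, L. P. Pryadko, arXiv:1202.0928, Examples 2 and 6 (toric codes as hypergraph products).
* [DennisEtAl2002] E. Dennis, A. Kitaev, A. Landahl, J. Preskill, J. Math. Phys. 43 (2002) 4452, arXiv:quant-ph/0110143, §5.3
  eqs. (p_c_2d), (threshold_iso_num).
* [LinPryadko2024] H.-K. Lin, L. P. Pryadko, §4.2 Thm 6 (permutation-equivalent CSS codes).
* [AliferisGottesmanPreskill2006] P. Aliferis, D. Gottesman, J. Preskill, arXiv:quant-ph/0504218, §8.2 (chunk p0026 L11: depolarizing).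
* [PonitzTittmann2000] A. Pönitz, P. Tittmann, Electron. J. Combin. 7 (2000) R21, Table 2 (`2.6939`, `4.7476`).
-/

noncomputable section

namespace Summit.Ventures.QEC.Thresholds

open Filter Topology Finset Matrix
open Literature.InformationTheory.QuantumCodes
open Literature.InformationTheory.QuantumCodes.ToricCode
open Literature.Probability.RandomPlanarGeometry

/-! ### Code capacity, `Z` sector -/

/-- **Size-by-size identity, `Z` sector**: the code-capacity failure probability of a decoder `D` of `HGP(circ_{k+2}, circ_{k+2})`
equals the lattice failure probability `failureProb (k+2)` of its pulled-back decoder. [cite: LinPryadko2024, §4.2 Thm 6] -/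
theorem toricHGP_zFailureFamily_eq_failureProb
    (D : ∀ k, Decoder ((Fin (k + 2) × Fin (k + 2)) → ZMod 2)
      (((Fin (k + 2) × Fin (k + 2)) ⊕ (Fin (k + 2) × Fin (k + 2))) → ZMod 2)) (k : ℕ) (p : ℝ) :
    zFailureFamily (fun k => toricHGPCode k) D k p =
      failureProb (k + 2)
        (fun s : Syndrome (k + 2) => D k (s ∘ ⇑(toricVertexEquiv k).symm.symm) ∘ ⇑(toricQubitEquiv k).symm) p := by
  simp only [zFailureFamily]
  convert CSSCode.zFailure_pullback (toricCode (k + 2)) (toricVertexEquiv k).symm (toricVertexEquiv k).symm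
    (toricQubitEquiv k).symm (D k) p using 6
  all_goals first | rfl | exact toricHGPCode_eq_reindex k | rw [toricHGPCode_eq_reindex]

/-- **Transfer principle, `Z` sector, code capacity**: a lattice toric threshold bound valid for EVERY minimum-weight decoder
family holds for every minimum-weight decoder family of the HGP object's `Z` sector. [cite: LinPryadko2024, §4.2 Thm 6]
[cite: DennisEtAl2002, §5.3 eq. (threshold_2d)] -/
theorem toricHGP_z_isThresholdLowerBound_of_lattice {p₀ : ℝ}
    (hZ : ∀ D' : (L : ℕ) → ZDecoder (L + 1),
      (∀ L, (D' L).IsMinWeight (syn (L + 1)) (cycles (L + 1)) hammingNorm) →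
        IsThresholdLowerBound (toricFailureFamily D') p₀)
    (D : ∀ k, Decoder ((Fin (k + 2) × Fin (k + 2)) → ZMod 2)
      (((Fin (k + 2) × Fin (k + 2)) ⊕ (Fin (k + 2) × Fin (k + 2))) → ZMod 2))
    (hD : ∀ k, (D k).IsMinWeight (toricHGPCode k).zSyndrome ((toricHGPCode k).kerX : Set _) hammingNorm) :
    IsThresholdLowerBound (zFailureFamily (fun k => toricHGPCode k) D) p₀ := by
  -- the lattice family: size 1 gets the canonical decoder, size k+2 the pull-back of `D k`
  let D' : (L : ℕ) → ZDecoder (L + 1) := fun L =>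
    match L with
    | 0 => Decoder.minWeight (syn 1) hammingNorm
    | k + 1 => fun s : Syndrome (k + 2) => D k (s ∘ ⇑(toricVertexEquiv k).symm.symm) ∘ ⇑(toricQubitEquiv k).symm
  have hD' : ∀ L, (D' L).IsMinWeight (syn (L + 1)) (cycles (L + 1)) hammingNorm := by
    intro L
    cases L with
    | zero => exact ToricCode.isMinWeight_minWeight 1
    | succ k =>
      have hk := hD k
      rw [toricHGPCode_eq_reindex] at hk
      have h := (toricCode (k + 2)).isMinWeight_zPullback _ _ _ hk
      exact ⟨fun e => by
        have := h.add_mem e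
        rwa [SetLike.mem_coe, CSSCode.mem_kerX_iff] at this, h.weight_le⟩
  have hfam : zFailureFamily (fun k => toricHGPCode k) D = fun k => toricFailureFamily D' (k + 1) := by
    funext k p
    exact toricHGP_zFailureFamily_eq_failureProb D k p
  rw [hfam, isThresholdLowerBound_succ_iff]
  exact hZ D' hD'

/-- **`Z`-sector code-capacity threshold of `HGP(circ_L, circ_L)` `≥ p₀(2.6939)`**, every minimum-weight decoder family —
UNCONDITIONAL, kernel. [cite: DennisEtAl2002, §5.3 eq. (threshold_2d)] -/
theorem toricHGP_z_isThresholdLowerBound_kernelSymmK16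
    (D : ∀ k, Decoder ((Fin (k + 2) × Fin (k + 2)) → ZMod 2)
      (((Fin (k + 2) × Fin (k + 2)) ⊕ (Fin (k + 2) × Fin (k + 2))) → ZMod 2))
    (hD : ∀ k, (D k).IsMinWeight (toricHGPCode k).zSyndrome ((toricHGPCode k).kerX : Set _) hammingNorm) :
    IsThresholdLowerBound (zFailureFamily (fun k => toricHGPCode k) D) (thresholdValue 2.6939) :=
  toricHGP_z_isThresholdLowerBound_of_lattice (fun _ hD' => toricThreshold_kernelSymmK16 hD') D hD

/-- **`p_c^Z > .0357` for `HGP(circ_L, circ_L)`** (was `.0285`), every minimum-weight decoder family — UNCONDITIONAL, kernel.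
[cite: DennisEtAl2002, §5.3 eq. (p_c_2d)] -/
theorem toricHGP_z_accuracyThreshold_gt_0357
    (D : ∀ k, Decoder ((Fin (k + 2) × Fin (k + 2)) → ZMod 2)
      (((Fin (k + 2) × Fin (k + 2)) ⊕ (Fin (k + 2) × Fin (k + 2))) → ZMod 2))
    (hD : ∀ k, (D k).IsMinWeight (toricHGPCode k).zSyndrome ((toricHGPCode k).kerX : Set _) hammingNorm) :
    (0.0357 : ℝ) < accuracyThreshold (zFailureFamily (fun k => toricHGPCode k) D) :=
  lt_of_lt_of_le thresholdValue_26939_bounds.1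
    (le_accuracyThreshold (toricHGP_z_isThresholdLowerBound_kernelSymmK16 D hD)
      ((thresholdValue_le_half _).trans (by norm_num)))

/-! ### Code capacity, `X` sector -/

/-- **Size-by-size identity, `X` sector** (re-indexing, then lattice duality `xFailureProb_eq_failureProb_dualDecoder`).
[cite: LinPryadko2024, §4.2 Thm 6] [cite: DennisEtAl2002, §4.1] -/
theorem toricHGP_xFailureFamily_eq
    (DX : ∀ k, Decoder ((Fin (k + 2) × Fin (k + 2)) → ZMod 2)
      (((Fin (k + 2) × Fin (k + 2)) ⊕ (Fin (k + 2) × Fin (k + 2))) → ZMod 2)) (k : ℕ) (p : ℝ) :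
    xFailureFamily (fun k => toricHGPCode k) DX k p =
      xFailureFamily (fun L => toricCode (L + 1))
        (fun L => match L with
          | 0 => Decoder.minWeight (toricCode 1).xSyndrome hammingNorm
          | k + 1 => fun s : Syndrome (k + 2) =>
              DX k (s ∘ ⇑(toricVertexEquiv k).symm.symm) ∘ ⇑(toricQubitEquiv k).symm)
        (k + 1) p := by
  simp only [xFailureFamily]
  convert CSSCode.xFailure_pullback (toricCode (k + 2)) (toricVertexEquiv k).symm (toricVertexEquiv k).symm
    (toricQubitEquiv k).symm (DX k) p using 6
  all_goals first | rfl | exact toricHGPCode_eq_reindex k | rw [toricHGPCode_eq_reindex]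

/-- **Transfer principle, `X` sector, code capacity** (through the lattice `X`-sector transfer `toric_x_isThresholdLowerBound_of_z`).
[cite: LinPryadko2024, §4.2 Thm 6] [cite: DennisEtAl2002, §4.1 and §5.3] -/
theorem toricHGP_x_isThresholdLowerBound_of_lattice {p₀ : ℝ}
    (hZ : ∀ D' : (L : ℕ) → ZDecoder (L + 1),
      (∀ L, (D' L).IsMinWeight (syn (L + 1)) (cycles (L + 1)) hammingNorm) →
        IsThresholdLowerBound (toricFailureFamily D') p₀)
    (DX : ∀ k, Decoder ((Fin (k + 2) × Fin (k + 2)) → ZMod 2)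
      (((Fin (k + 2) × Fin (k + 2)) ⊕ (Fin (k + 2) × Fin (k + 2))) → ZMod 2))
    (hDX : ∀ k, (DX k).IsMinWeight (toricHGPCode k).xSyndrome ((toricHGPCode k).kerZ : Set _) hammingNorm) :
    IsThresholdLowerBound (xFailureFamily (fun k => toricHGPCode k) DX) p₀ := by
  let DX' : (L : ℕ) → Decoder (Syndrome (L + 1)) (Chain (L + 1)) := fun L =>
    match L with
    | 0 => Decoder.minWeight (toricCode 1).xSyndrome hammingNorm
    | k + 1 => fun s : Syndrome (k + 2) => DX k (s ∘ ⇑(toricVertexEquiv k).symm.symm) ∘ ⇑(toricQubitEquiv k).symm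
  have hDX' : ∀ L, (DX' L).IsMinWeight (toricCode (L + 1)).xSyndrome ((toricCode (L + 1)).kerZ : Set _) hammingNorm := by
    intro L
    cases L with
    | zero => exact toric_isMinWeight_minWeight_x 0
    | succ k =>
      have hk := hDX k
      rw [toricHGPCode_eq_reindex] at hk
      exact (toricCode (k + 2)).isMinWeight_xPullback _ _ _ hk
  have hfam : xFailureFamily (fun k => toricHGPCode k) DX = fun k => xFailureFamily (fun L => toricCode (L + 1)) DX' (k + 1) := by
    funext k p
    exact toricHGP_xFailureFamily_eq DX k p
  rw [hfam, isThresholdLowerBound_succ_iff]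
  exact toric_x_isThresholdLowerBound_of_z hZ DX' hDX'

/-- **`X`-sector code-capacity threshold of `HGP(circ_L, circ_L)` `≥ p₀(2.6939)`**, every minimum-weight decoder family —
UNCONDITIONAL, kernel. [cite: DennisEtAl2002, §5.3 eq. (threshold_2d)] -/
theorem toricHGP_x_isThresholdLowerBound_kernelSymmK16
    (DX : ∀ k, Decoder ((Fin (k + 2) × Fin (k + 2)) → ZMod 2)
      (((Fin (k + 2) × Fin (k + 2)) ⊕ (Fin (k + 2) × Fin (k + 2))) → ZMod 2))
    (hDX : ∀ k, (DX k).IsMinWeight (toricHGPCode k).xSyndrome ((toricHGPCode k).kerZ : Set _) hammingNorm) :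
    IsThresholdLowerBound (xFailureFamily (fun k => toricHGPCode k) DX) (thresholdValue 2.6939) :=
  toricHGP_x_isThresholdLowerBound_of_lattice (fun _ hD' => toricThreshold_kernelSymmK16 hD') DX hDX

/-- **`p_c^X > .0357` for `HGP(circ_L, circ_L)`** (was `.0285`), every minimum-weight decoder family — UNCONDITIONAL, kernel.
[cite: DennisEtAl2002, §5.3 eq. (p_c_2d)] -/
theorem toricHGP_x_accuracyThreshold_gt_0357
    (DX : ∀ k, Decoder ((Fin (k + 2) × Fin (k + 2)) → ZMod 2)
      (((Fin (k + 2) × Fin (k + 2)) ⊕ (Fin (k + 2) × Fin (k + 2))) → ZMod 2))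
    (hDX : ∀ k, (DX k).IsMinWeight (toricHGPCode k).xSyndrome ((toricHGPCode k).kerZ : Set _) hammingNorm) :
    (0.0357 : ℝ) < accuracyThreshold (xFailureFamily (fun k => toricHGPCode k) DX) :=
  lt_of_lt_of_le thresholdValue_26939_bounds.1
    (le_accuracyThreshold (toricHGP_x_isThresholdLowerBound_kernelSymmK16 DX hDX)
      ((thresholdValue_le_half _).trans (by norm_num)))

/-! ### Depolarizing noise, sector-wise decoding -/

/-- **Depolarizing threshold of `HGP(circ_L, circ_L)` `≥ (3/2)·p₀(2.6939)`**, sector-wise minimum-weight decoding (any pair of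
minimum-weight decoder families) — UNCONDITIONAL, kernel. [cite: AliferisGottesmanPreskill2006, §8.2 (chunk p0026 L11)]
[cite: DennisEtAl2002, §5.3 eq. (threshold_2d)] -/
theorem toricHGP_depolarizing_isThresholdLowerBound_kernelSymmK16
    (DX DZ : ∀ k, Decoder ((Fin (k + 2) × Fin (k + 2)) → ZMod 2)
      (((Fin (k + 2) × Fin (k + 2)) ⊕ (Fin (k + 2) × Fin (k + 2))) → ZMod 2))
    (hDX : ∀ k, (DX k).IsMinWeight (toricHGPCode k).xSyndrome ((toricHGPCode k).kerZ : Set _) hammingNorm)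
    (hDZ : ∀ k, (DZ k).IsMinWeight (toricHGPCode k).zSyndrome ((toricHGPCode k).kerX : Set _) hammingNorm) :
    IsThresholdLowerBound (depolarizingFailureFamily (fun k => toricHGPCode k) DX DZ) (3 / 2 * thresholdValue 2.6939) := by
  have h := depolarizing_isThresholdLowerBound (fun k => toricHGPCode k) DX DZ
    (toricHGP_x_isThresholdLowerBound_kernelSymmK16 DX hDX) (toricHGP_z_isThresholdLowerBound_kernelSymmK16 DZ hDZ)
    ((min_le_left _ _).trans (thresholdValue_le_two_thirds _))
  rwa [min_self] at h

/-- **`p_c^{depol} > .0535` for `HGP(circ_L, circ_L)`** (was `.0427`), sector-wise minimum-weight decoding — UNCONDITIONAL, kernel.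
[cite: AliferisGottesmanPreskill2006, §8.2 (chunk p0026 L11)] [cite: DennisEtAl2002, §5.3 eq. (p_c_2d)] -/
theorem toricHGP_depolarizing_accuracyThreshold_gt_0535
    (DX DZ : ∀ k, Decoder ((Fin (k + 2) × Fin (k + 2)) → ZMod 2)
      (((Fin (k + 2) × Fin (k + 2)) ⊕ (Fin (k + 2) × Fin (k + 2))) → ZMod 2))
    (hDX : ∀ k, (DX k).IsMinWeight (toricHGPCode k).xSyndrome ((toricHGPCode k).kerZ : Set _) hammingNorm)
    (hDZ : ∀ k, (DZ k).IsMinWeight (toricHGPCode k).zSyndrome ((toricHGPCode k).kerX : Set _) hammingNorm) :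
    (0.0535 : ℝ) < accuracyThreshold (depolarizingFailureFamily (fun k => toricHGPCode k) DX DZ) := by
  have h := thresholdValue_26939_bounds.1
  have hv := thresholdValue_le_half (2.6939 : ℝ)
  exact lt_of_lt_of_le (by linarith)
    (le_accuracyThreshold (toricHGP_depolarizing_isThresholdLowerBound_kernelSymmK16 DX DZ hDX hDZ) (by linarith))

end Summit.Ventures.QEC.Thresholds

end
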